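import Mathlib
import Summits.AtomisticToContinuum.Crystallization.Theses.ChessboardParticlePlanes
import Summits.AtomisticToContinuum.Crystallization.Theorems.ChessboardParticlePlanesLjLaminarWindowsMinDistance
import Summits.AtomisticToContinuum.Crystallization.Theorems.ChessboardParticlePlanesLjLaminarWindowsGlueC5
import Summits.AtomisticToContinuum.Crystallization.Theorems.ChessboardParticlePlanesLjLaminarWindowsRemoval
import Summits.AtomisticToContinuum.Crystallization.Theorems.ChessboardParticlePlanesLjLaminarWindowsShellBound
import Summits.AtomisticToContinuum.Crystallization.Theorems.ChessboardParticlePlanesLjLaminarWindowsPathCount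
import HarnessLib

/-!
# The glue at the ONE-WINDOW residual of line `Sketch` — crux `LjLaminarWindows`
(stmt-AtomisticToContinuum-6711), skeleton rev. 17, lead c11

Rev. 16 of the line reduced the crux to a DENSITY residual (frequently in `N`, fewer than `δ N` particles are
non-`(η, L)`-laminar, for every `δ > 0`), because its glue (`stub_glueNSF` / `glueNSF_at`) intersects "laminar"
with "non-spiky" by pigeonhole.  The landed NSF stubs are LOCAL, however (`stub_massBound`, `stub_sparseAllSpiky`:
a `θ`-non-spiky particle lies within `2L²` of any particle that sees a particle beyond `2L`), and laminarity is
inherited by sub-windows.  This file proves the corresponding glue `stub_cruxOfOneWindow`: taking the three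
geometric inputs as hypotheses (they are the registered stubs `stub_localNonSpiky`, `stub_farParticle`,
`stub_subWindow` of rev. 17, landed separately), the ONE-WINDOW residual — literally the laminarity clause of the
crux, one window per large radius, frequently in `N` — implies the crux body.  Since the crux trivially implies
that residual, rev. 17 makes `LjLaminarWindows` EQUIVALENT to its own laminarity clause (assembled in
`…LjLaminarWindowsOneWindow.lean` once the three stubs land).  Inputs used here, all tree theorems: `7/10` minimal
distance (`lennardJones_groundState_dist_ge_seven_tenths`), `23/20` connectivity (`glueC5_connected`), window
removal (`stub_windowRemoval`), shell bound (`stub_shellBound`), path count (`stub_pathCount`).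
-/

noncomputable section

open scoped BigOperators
open Filter Topology
open Literature.MathematicalPhysics.StatisticalMechanics
open Summit.AtomisticToContinuum.Crystallization.Theorems.ChargedEnergyGapNegative

namespace Summit.AtomisticToContinuum.Crystallization.Theorems.LjLaminarWindowsSketch

/-- **Registered glue `stub_cruxOfOneWindow` of skeleton rev. 17 (line `Sketch`, lead c11).** From local
non-spikiness (`hLNS`, registered stub `stub_localNonSpiky`), far particles (`hFar`, `stub_farParticle`) and
sub-window inheritance of laminarity (`hSub`, `stub_subWindow`): the ONE-WINDOW laminarity residual — for every
ground-state sequence and every `η > 0`, for all large radii, frequently in `N`, SOME particle-centred window is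
`η`-laminar (clauses 1 and 3 of the crux) — implies the body of the crux `LjLaminarWindows`.  Pattern of
`glueNSF_at` (…Residual.lean) with the pigeonhole replaced: given `η, ε`, fix `k₀` (window removal
`stub_windowRemoval` at `ε/4`), `R, C` (shell bound `stub_shellBound` at `ε/4`), `θ` with `Cθ ≤ ε/4`, `L₃` (`hLNS`);
for `L ≥ max(L₃, 1, 23k₀/20, L₁)` apply the residual at radius `2L² + L`; eventually `N > (40L/7 + 1)³`, so every
particle sees one beyond `2L` (`hFar`); `hLNS` at the laminar centre gives a `θ`-non-spiky `p` within `2L²`, whose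
`L`-window is `η`-laminar (`hSub`), holds `≥ 20L/23 ≥ k₀` particles (`stub_pathCount`), and satisfies the energy
clause by window removal + shell bound + non-spikiness. [folklore] -/
theorem stub_cruxOfOneWindow :
    (∀ θ R : ℝ, 0 < θ → θ < 1 → 1 ≤ R → ∃ L₀ : ℝ, ∀ L : ℝ, L₀ ≤ L → ∀ (N : ℕ) (x : Fin N → E3),
      (∀ j k : Fin N, j ≠ k → (7 : ℝ) / 10 ≤ dist (x j) (x k)) →
      (∀ S : Finset (Fin N), S.Nonempty → Sᶜ.Nonempty →
          ∃ p ∈ S, ∃ k ∈ Sᶜ, dist (x p) (x k) ≤ 23 / 20) →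
      ∀ p₀ : Fin N, (∃ j : Fin N, 2 * L < dist (x j) (x p₀)) →
        ∃ p : Fin N, dist (x p) (x p₀) ≤ 2 * L ^ 2 ∧
          ((Finset.univ.filter fun q : Fin N =>
              L - R < dist (x q) (x p) ∧ dist (x q) (x p) ≤ L).card : ℝ) ≤
            θ * ((Finset.univ.filter fun q : Fin N => dist (x q) (x p) ≤ L).card : ℝ)) →
    (∀ (N : ℕ) (x : Fin N → E3), (∀ j k : Fin N, j ≠ k → (7 : ℝ) / 10 ≤ dist (x j) (x k)) →
      ∀ L : ℝ, 0 ≤ L → (2 * (2 * L) / (7 / 10) + 1) ^ 3 < (N : ℝ) →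
        ∀ p₀ : Fin N, ∃ j : Fin N, 2 * L < dist (x j) (x p₀)) →
    (∀ (N : ℕ) (x : Fin N → E3) (i p : Fin N) (L L' η : ℝ) (A : E3 →ₗᵢ[ℝ] E3) (T : Set ℝ),
      (∀ t ∈ T, ∀ t' ∈ T, t ≠ t' → (3 : ℝ) / 4 ≤ |t - t'|) →
      (∀ j : Fin N, dist (x j) (x i) ≤ L' → ∃ t ∈ T, |(A (x j - x i)) 2 - t| ≤ η) →
      dist (x p) (x i) + L ≤ L' →
      ∃ T' : Set ℝ, (∀ t ∈ T', ∀ t' ∈ T', t ≠ t' → (3 : ℝ) / 4 ≤ |t - t'|) ∧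
        ∀ j : Fin N, dist (x j) (x p) ≤ L → ∃ t ∈ T', |(A (x j - x p)) 2 - t| ≤ η) →
    (∀ x : (N : ℕ) → (Fin N → EuclideanSpace ℝ (Fin 3)), (∀ N, IsGroundState lennardJones (x N)) →
      ∀ η : ℝ, 0 < η → ∃ L₀ : ℝ, ∀ L : ℝ, L₀ ≤ L → ∃ᶠ N in Filter.atTop,
        ∃ (i : Fin N) (A : EuclideanSpace ℝ (Fin 3) →ₗᵢ[ℝ] EuclideanSpace ℝ (Fin 3)) (T : Set ℝ),
          (∀ t ∈ T, ∀ t' ∈ T, t ≠ t' → (3 : ℝ) / 4 ≤ |t - t'|) ∧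
          (∀ j : Fin N, dist (x N j) (x N i) ≤ L → ∃ t ∈ T, |(A (x N j - x N i)) 2 - t| ≤ η)) →
    ∀ x : (N : ℕ) → (Fin N → EuclideanSpace ℝ (Fin 3)), (∀ N, IsGroundState lennardJones (x N)) →
      ∀ η ε : ℝ, 0 < η → 0 < ε → ∃ L₀ : ℝ, ∀ L : ℝ, L₀ ≤ L → ∃ᶠ N in Filter.atTop,
        ∃ (i : Fin N) (A : EuclideanSpace ℝ (Fin 3) →ₗᵢ[ℝ] EuclideanSpace ℝ (Fin 3)) (T : Set ℝ),
          (∀ t ∈ T, ∀ t' ∈ T, t ≠ t' → (3 : ℝ) / 4 ≤ |t - t'|) ∧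
          (∀ j k : Fin N, j ≠ k → dist (x N j) (x N i) ≤ L → dist (x N k) (x N i) ≤ L →
            (7 : ℝ) / 10 ≤ dist (x N j) (x N k)) ∧
          (∀ j : Fin N, dist (x N j) (x N i) ≤ L → ∃ t ∈ T, |(A (x N j - x N i)) 2 - t| ≤ η) ∧
          (∑ j : Fin N, ∑ k : Fin N, if j ≠ k ∧ dist (x N j) (x N i) ≤ L ∧ dist (x N k) (x N i) ≤ L
              then lennardJones (dist (x N j) (x N k)) else 0) ≤
            2 * ((⨅ Q : PeriodicConfiguration 3, Q.energyPerParticle lennardJones) + ε) *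
              (Nat.card {j : Fin N // dist (x N j) (x N i) ≤ L} : ℝ) := by
  intro hLNS hFar hSub hOne x hx η ε hη hε
  classical
  -- ground-state facts used throughout
  have hsep : ∀ (N : ℕ) (j k : Fin N), j ≠ k → (7 : ℝ) / 10 ≤ dist (x N j) (x N k) :=
    fun N j k hjk => lennardJones_groundState_dist_ge_seven_tenths (hx N) hjk
  have hconn : ∀ (N : ℕ) (S : Finset (Fin N)), S.Nonempty → Sᶜ.Nonempty →
      ∃ p ∈ S, ∃ k ∈ Sᶜ, dist (x N p) (x N k) ≤ 23 / 20 := fun N => glueC5_connected (hx N)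
  -- constants
  obtain ⟨k₀, hk₀⟩ := stub_windowRemoval (ε / 4) (by positivity)
  obtain ⟨R, C, hR1, hC, hSB'⟩ := stub_shellBound (ε / 4) (by positivity)
  obtain ⟨θ, hθ, hθ1, hCθ⟩ : ∃ θ : ℝ, 0 < θ ∧ θ < 1 ∧ C * θ ≤ ε / 4 := by
    refine ⟨min (ε / (4 * C)) (1 / 2), lt_min (by positivity) (by norm_num),
      lt_of_le_of_lt (min_le_right _ _) (by norm_num), ?_⟩
    calc C * min (ε / (4 * C)) (1 / 2) ≤ C * (ε / (4 * C)) :=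
          mul_le_mul_of_nonneg_left (min_le_left _ _) hC.le
      _ = ε / 4 := by field_simp
  obtain ⟨L₃, hL₃⟩ := hLNS θ R hθ hθ1 hR1
  obtain ⟨L₁, hL₁⟩ := hOne x hx η hη
  refine ⟨max (max (max L₃ 1) (23 / 20 * k₀)) L₁, fun L hL => ?_⟩
  have hLa : max (max L₃ 1) (23 / 20 * (k₀ : ℝ)) ≤ L := le_trans (le_max_left _ _) hL
  have hL1 : 1 ≤ L := le_trans (le_trans (le_max_right _ _) (le_max_left _ _)) hLa
  have hLpos : 0 < L := by linarith
  have hLk : 23 / 20 * (k₀ : ℝ) ≤ L := le_trans (le_max_right _ _) hLa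
  have hL₃L : L₃ ≤ L := le_trans (le_trans (le_max_left _ _) (le_max_left _ _)) hLa
  have hLL₁ : L₁ ≤ L := le_trans (le_max_right _ _) hL
  -- the one-window residual at the big radius `L' = 2L² + L` (frequently in `N`)
  have hsq : 0 ≤ 2 * L ^ 2 := by positivity
  have hL₁' : L₁ ≤ 2 * L ^ 2 + L := by linarith
  have hE1 := hL₁ (2 * L ^ 2 + L) hL₁'
  -- eventually in `N`: more particles than any closed `2L`-ball can hold
  have hE2 : ∀ᶠ N : ℕ in atTop, (2 * (2 * L) / (7 / 10) + 1) ^ 3 < (N : ℝ) := by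
    obtain ⟨M, hM⟩ := exists_nat_gt ((2 * (2 * L) / (7 / 10) + 1) ^ 3)
    refine (eventually_ge_atTop M).mono fun N hN => lt_of_lt_of_le hM ?_
    exact_mod_cast hN
  refine (hE1.and_eventually hE2).mono ?_
  rintro N ⟨⟨i, A, T, hT, hlamT⟩, h2⟩
  have hxN := hx N
  have hfarAll : ∀ p₀ : Fin N, ∃ j : Fin N, 2 * L < dist (x N j) (x N p₀) :=
    fun p₀ => hFar N (x N) (hsep N) L hLpos.le h2 p₀
  -- a non-spiky particle `p` within `2L²` of the laminar centre `i`
  obtain ⟨p, hpi, hsp⟩ := hL₃ L hL₃L N (x N) (hsep N) (hconn N) i (hfarAll i)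
  -- its `L`-window is `η`-laminar
  obtain ⟨T', hT', hlamin⟩ := hSub N (x N) i p L (2 * L ^ 2 + L) η A T hT hlamT (by linarith)
  -- ball and shell of `p`
  set B : Finset (Fin N) := Finset.univ.filter fun j : Fin N => dist (x N j) (x N p) ≤ L with hB
  set w : ℝ := ((Finset.univ.filter fun j : Fin N => dist (x N j) (x N p) ≤ L).card : ℝ) with hw
  set s : ℝ := ((Finset.univ.filter fun j : Fin N =>
    L - R < dist (x N j) (x N p) ∧ dist (x N j) (x N p) ≤ L).card : ℝ) with hs
  have hsi : s ≤ θ * w := hsp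
  have hBcard : (B.card : ℝ) = w := rfl
  -- (b) the window holds at least `k₀` particles (path count from the far particle of `p`)
  have hBk : k₀ ≤ B.card := by
    have hfar : ∃ j : Fin N, L < dist (x N j) (x N p) := by
      obtain ⟨j, hj⟩ := hfarAll p
      exact ⟨j, by linarith⟩
    have hpc := stub_pathCount N (x N) (23 / 20) (by norm_num) (hconn N) p L
      hLpos.le hfar
    have h' : (k₀ : ℝ) ≤ L / (23 / 20) := by
      rw [le_div_iff₀ (by norm_num : (0 : ℝ) < 23 / 20)]
      linarith
    exact_mod_cast h'.trans hpc
  -- (c) window removal and the shell bound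
  have hrem := hk₀ N (x N) hxN B hBk
  have hcross := hSB' N (x N) (hsep N) p L
  have hBc : Bᶜ = Finset.univ.filter fun k : Fin N => ¬ dist (x N k) (x N p) ≤ L := by
    rw [hB, Finset.compl_filter]
  have hneg : -(∑ j ∈ B, ∑ k ∈ Bᶜ, lennardJones (dist (x N j) (x N k))) ≤
      ∑ j ∈ B, ∑ k ∈ Finset.univ.filter (fun k : Fin N => ¬ dist (x N k) (x N p) ≤ L),
        max (-lennardJones (dist (x N j) (x N k))) 0 := by
    rw [hBc, ← Finset.sum_neg_distrib]
    refine Finset.sum_le_sum fun j _ => ?_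
    rw [← Finset.sum_neg_distrib]
    exact Finset.sum_le_sum fun k _ => le_max_left _ _
  have hw0 : 0 ≤ w := Nat.cast_nonneg _
  have hshell : C * s ≤ ε / 4 * w := by
    have h1 : C * s ≤ C * (θ * w) := mul_le_mul_of_nonneg_left hsi hC.le
    have h2' : C * θ * w ≤ ε / 4 * w := mul_le_mul_of_nonneg_right hCθ hw0
    rw [← mul_assoc] at h1
    exact h1.trans h2'
  have henergy : ∑ j ∈ B, ∑ k ∈ B, lennardJones (dist (x N j) (x N k)) ≤
      2 * (eStar + ε) * (B.card : ℝ) := by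
    have hcross' : ∑ j ∈ B, ∑ k ∈ Finset.univ.filter (fun k : Fin N => ¬ dist (x N k) (x N p) ≤ L),
        max (-lennardJones (dist (x N j) (x N k))) 0 ≤ ε / 4 * w + C * s := hcross
    rw [hBcard]
    nlinarith [hrem, hneg, hcross', hshell, hw0, hε]
  -- (d) assemble
  refine ⟨p, A, T', hT', fun j k hjk _ _ => hsep N j k hjk, hlamin, ?_⟩
  rw [← glueC5_window_sum_eq (x N) p L, glue_natCard_filter]
  exact henergy

end Summit.AtomisticToContinuum.Crystallization.Theorems.LjLaminarWindowsSketch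

end
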